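import Literature.IUT.HodgeTheaters.BadLocalFrobenioidOfKitsTemperedBiratReal
import Literature.IUT.HodgeTheaters.GenuineFKitOfBadLocalTemperedCFromFSlim
import Literature.IUT.HodgeTheaters.GenuineFKitOfBadLocalTemperedSideNV
import Literature.AnabelianGeometry.EtaleTheta.ArithThetaTowerThetaRestBirat
import Literature.AnabelianGeometry.EtaleTheta.ArithThetaTowerCarrierProp34
import Literature.AnabelianGeometry.EtaleTheta.ArithThetaTowerNonDilatingModel
import Literature.AnabelianGeometry.EtaleTheta.ArithThetaTowerCor38ii
import HarnessLib

/-!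
# [IUTchI] Ex. 3.2 (i)(ii)(iii) — THE L5 KNIT: the GENUINE (m1) `InitialThetaData.badTemperedRestArith` of the `ℱ`-kit at every bad
# index, over the pair's own `Π_{X̳̲_v̲}`, and the NV one-calls (ii)/(iii)/(vi) at the merge record `MergeInputs.ofArith` (GAP A item GA-07)

S. Mochizuki, *Inter-universal Teichmüller Theory I* [Mochizuki2012], Ex. 3.2 (i) p.70 («the hyperbolic curve `X̲̲_v` determines a
tempered Frobenioid `ℱ̲_v` over the base category `𝒟_v`»), (ii) pp.70–71 («`ℱ÷_v := ℱ̲_v^birat`», «`Θ̲_v ∈ 𝒪^×(T^÷_{Ÿ_v})`», «`l·ℤ ⊆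
Aut(T_{Ÿ_v})`», «`ℱ÷_v` may be reconstructed category-theoretically from `ℱ̲_v`»), (iii) p.71 («`𝒞_v ⊆ ℱ̲_v` … may be reconstructed
category-theoretically from `ℱ̲_v` [cf. [EtTh], Corollary 3.8, (ii)]»), (iv) p.71, (v) p.72, (vi) p.73 ([IUTchI] Ex 3.2 (i) p.70)
[claim: Mochizuki2012, status: disputed] (D-0012 claim key, series status DISPUTED — a CONSTRUCTION over OUR typed objects plus
compositions BY NAME; nothing of the series is asserted; no side is taken on [IUTchIII] Cor. 3.12); S. Mochizuki, *The étale theta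
function …* [MochizukiEtTh2009], Def. 3.6 (ii) p.77, Cor. 3.8 (ii) p.81; *The geometry of Frobenioids I* [MochizukiFrdI2008], Thm. 5.2 (ii) p.101.

GAP A of record G-L5-EX32I-1 (abc-iut cell; the UNDISPUTED construction around [IUTchIII] Cor. 3.12 of the [EtTh] Def. 3.6 tempered
Frobenioid at a bad place), item **GA-07** = D7 of GAP-SIZING-A.md 69de97346848d3e8, THE L5 KNIT — the row the L5 chair tokens under
RULINGS #317 (2) (`plan/GAP-ITEMS.tsv` v1.1 288962aeb33dac1e row GA-07 = scope of record, cut of record v0.2 cb1ce7045e887496; ruled shape `plan/L5/GAP-A-SIGNATURES.md` v2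
bd8d4ceaa15d54d7 §5 last display modulo the one-token ‹hF› edit of record + §8 D7 line; RULINGS #317 (2) / #319 (c1)–(c4) / #322 (c2′)(c3′)
/ #339 (2) no extra binder / #341 (B) `l :=` the datum's prime / #342 (D) / #344 (B)(ii)(iii) Θ̲-reading mandatory / #355 (C) `hF` spelling /
#357 (C) consume BY NAME what is accepted at knit time / #358 (A) A-token ruling of record), seat
abc-iut-gapA-07-badTemperedRestArithKnit (L5-knit class).  STATE BEFORE THIS FILE: the slot `InitialThetaData.BadTemperedRestBirat B x hx T`
(⟨`D₀`, `T′`, `VD`, `Fr`, `hF`, `R : TemperedThetaRestBirat …`⟩, `…TemperedBiratReal` :215) is the INPUT shape of the L2 lane; its two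
inhabitants of record are MODELS; (ii) is UNCONDITIONAL at the slot (`biratFromF_frobeniusBadAt_ofRestBirat`), (iii) holds modulo the [EtTh]
Cor. 3.8 (ii) bundle {`hnd`, `hds`, `hF`, `h5`, `hR`} on the L2 input (`cFromF_frobeniusBadAt_ofRest`), and the FOUNDATIONS-BOUNDARY HOLD
on Ex. 3.2 (i) says the tree has no genuine producer of (m1).

WHAT THIS FILE DOES (ONE `def` of record + compositions BY NAME; NO residual lemma is written here — GA-14's r1–r3 are GA-02's THEOREMS at
`realified d T` ★ p676754 and `hnd` at the term is GA-08's ★ p677621, keeper-A's ALL-NAMES route l.121973):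
* §1 **`InitialThetaData.badTemperedRestArith D B x hx T : D.BadTemperedRestBirat B x hx T`** — THE PRODUCER, for ARBITRARY `(D, x ∈
  V̲^bad, T)`, at `d := D.gvdAt x _` (`K_v̲ = K_w`, `Ω = K̄_w`), `P := ↥(B x hx).H` (the pair's `Π_{X̳̲_v̲}`), `q̲ := D.qRootAtIdx x hx`:
  `D₀ := T.Dv = 𝒟_v̲`, `T′ := realified d T` (GA-03 ★ p672371), `VD := catVocab d T` (GA-04 ★ p667989), `Fr := temperedFrobenioid d T` (THE
  TERM, GA-12 F3 ★ p675527 :139), `hF := isFrobenioid_temperedFrobenioid d T` (:158; it IS GA-05's hypothesis-free `isFrobenioid_realifiedOf …`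
  ★ p669819 at the term — the one-token ‹hF› edit of record), `R := thetaRestBirat_of_carrierSpec (carrierSpec_temperedFrobenioid d T) hF
  (D.qRootAtIdx_not_isUnit x hx) l` (GA-16 ★ p673462 :351 — `Θ̲_v := theta hC hF`, `l·ℤ := lZ hC l` with `l` THE DATUM'S PRIME, the GENUINE
  constants via `T.proj`, `𝒞⊢_v → 𝒞_v := cdashToC hC hq` (GA-13, faithful over all of `𝒟⊢_v ⊆ 𝒟_v`), and THE Θ̲-READING `𝒞^Θ_v ⊆ ℱ÷_v :=
  cThetaToBirat hC hF hq` (GA-06 ★ p671807; faithful/base GA-16; its Θ̲-compatibility «`q̲_v|_{T_A} ↦ Θ̲_v|_{T_{A^Θ}}`» is GA-06's (β)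
  `cThetaToBirat_map_genHom` ★) — NEVER the constants composite); read-outs of every field BY NAME (`badTemperedRestArith_R/_Fr/_CThetaToBirat/…`;
  `Fbirat := PreFrobenioid.toBirat` is FORCED by the slot, `BadTemperedRestBirat.toRest_Fr`/`TemperedThetaRestBirat.toRest_birat`), and
  `nonempty_badTemperedRestBirat` (PRODUCER A of `Cruxes/ThetaPartII/GapSizingA1Sketch.lean` §1, inhabited by THE `def`).
* §2 **`MergeInputs.ofArith D B m2 m4 geomTFG`** := `MergeInputs.ofRestBirat` AT THE GENUINE (m1) `fun x hx => D.badTemperedRestArith B x hx (m2 x hx)`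
  — binders (m2), (m4), F-0240 ONLY ((m1) is PRODUCED, not posited); `MergeInputs.ofArithModuli` with (m4) := `𝒞⊩_mod` (binders (m2) + F-0240).
* §3 THE NV ONE-CALLS AT A GENUINE BAD INDEX, every law at the term, none vacuous (RULINGS #319 (c1)): (ii) `biratFromF_frobeniusBadAt_ofArith` —
  residual NONE; (iii) `cFromF_frobeniusBadAt_ofArith` — the [EtTh] Cor. 3.8 (ii) bundle DISCHARGED BY NAME under H+ (`hnd` := GA-08's
  `isNonDilating_temperedFrobenioid d T` ★ p677621 = `isNonDilating_of_carrierSpec hC hD` with `hD := pullDichotomy_temperedFrobenioid d T`, binder-free;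
  `hF := isFrobenioid_temperedFrobenioid d T`; `h5 := cor38ii_h5_of_carrierSpec hC hF hP34Λ hZQ`, `hR := cor38ii_hR C hP34Λ hFinv` (GA-14 ★ p670391,
  #342 (D)) with r1 `hP34Λ := realified_mem_FΛ_of_divΛ_eq_of d T` / r2 `hFinv := realified_exists_inv_FΛ d T` / r3 `hZQ := realified_isZQMonoprime d T`
  (GA-02 ★ p676754) — modulo the Div-slimness clause `hds` of `𝒟_v̲` ONLY; `…_of_isSlimGroup` with `hds` discharged from the
  pair closed + slim (★ p511706) — NO L2-input binder left; the joint (ii) ∧ (iii) `ex32_ii_iii_frobeniusBadAt_ofArith[_of_isSlimGroup]`;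
  (vi) `ex32_iii_vi_cd_frobeniusBadAt_ofArith_of_isClosed_of_ker_slim` = (iii) ∧ (vi)(c) ∧ (vi)(d) modulo the group side {`hH`, `hK`} and the
  [FrdI] Thm. 3.4 (v) bundles {`hF′`, `hC`} ONLY (the Cor. 3.8 (ii) bundle GONE).
* §4 `cFromF_frobeniusBadAt_ofArith_standIn_of_geom_slim` — (iii) at the STAND-IN family (`badPairAtArrow hA`, `m2StandIn`) with the genuine
  (m1): modulo the merge's own origin inputs and F-0004₁ `hΔC : IsSlimGroup D.DeltaC` ONLY (chair's optional rider, RULINGS #362).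
BINDER CENSUS: §1 {`D`, `B`, `x`, `hx`, `T`}; §2 {`m2`, `m4`, `geomTFG`}; §3 adds `Fact (primeAt x).Prime` (= the theorem `fact_primeAt_prime`)
and EXACTLY the displayed residual group-side / [FrdI] Thm. 3.4 (v) binders; NO finite-index binder (#339 (2)), no `T'`-clause, no `hnd`/`h5`/`hR`/`hF`
binder; FACT unnamed 0; instance 0; notation 0; attribute 0; no `sorry`.
carrier: genuine-by-[EtTh]-recipe on the T-lattice (Ÿ_T, Ÿ_T × V, X̲̲_v̲ × V) + constants everywhere; off-lattice Φ via `rebase`/pullback;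
[EtTh] Def 3.3 Φ at general U and print's Ÿ̈/μ_N Kummer levels = FOUNDATIONS 13/14, not claimed (#322 (c3′) — the label is GA-02/GA-12's;
THIS file defines no carrier, it knits the term into the slot).  GUARD (#322): for a `T` that is not a finite level of the theta tower the
carrier is print's recipe TRANSPORTED by (n_T, e(V|K_v̲)); the finite avatar of `l·ℤ` is LABELLED (FOUNDATIONS 13 U2), never `≅ ℤ`.
HONEST FRAMING: the knit of an UNDISPUTED construction around [IUTchIII] Cor. 3.12 at OUR typed objects (GA-10's decreed, labelled
finite-level envelope with genuine constants) into the L5 slot; `temperedFrobenioid d T` is the inhabitant of OUR spec S0, NOT print's `ℱ̲_v̲`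
of the actual Tate curve and NOT a theorem of print; typed ≠ inhabited-in-print ≠ proved-in-print ≠ tokened; COUNT-NEUTRAL until the L5
chair tokens the headline row by a RULINGS line (the seat never flips a token); [IUTchIII] Cor. 3.12 stays OPEN by charter (D-0045) — no
side is taken on it or on any author; nothing here asserts the abc conjecture proved or refuted; MORATORIUM rq128 untouched.
-/

noncomputable section

namespace Literature.IUT.HodgeTheaters

open CategoryTheory Opposite _root_.NumberField _root_.IsDedekindDomain Literature.NumberTheory.NumberFields
  Literature.AlgebraicGeometry.Frobenioids Literature.AlgebraicGeometry.Frobenioids.PadicFrd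
  Literature.AnabelianGeometry.SemiGraphs Literature.AnabelianGeometry.EtaleTheta
  Literature.AnabelianGeometry.EtaleTheta.ArithThetaTower _root_.Topology

variable {F K Fbar : Type} [Field F] [NumberField F] [Field K] [NumberField K] [Algebra F K]
  [Field Fbar] [Algebra F Fbar] [Algebra K Fbar] {E : WeierstrassCurve F}
  [E.IsElliptic] {l : ℕ} {Pb : BadPlacePredicates K} (D : InitialThetaData F K Fbar E l Pb)
  (B : ∀ v, v ∈ D.indexCopyBad → D.BadPairAt v)

namespace InitialThetaData

/-! ### §1 THE PRODUCER `badTemperedRestArith` (GAP-A-SIGNATURES §5 D7, RULINGS #317 (2)) -/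

section Producer

variable (x : D.IndexCopy) (hx : x ∈ D.indexCopyBad)
  (T : BadLocalGroupDatum (D.GalAt x (D.not_mem_arc_of_mem_bad hx)) ↥(B x hx).H)

/-- **[IUTchI] Ex. 3.2 (i)(ii)(iv)(v) — THE GENUINE (m1) OF THE `ℱ`-KIT AT A BAD INDEX** (GAP A row D7, RULINGS #317 (2): the `def`, not a
hypothesis, not a model), for ARBITRARY `(D, x ∈ V̲^bad, T)` over the pair's own `Π_{X̳̲_v̲} = ↥(B x hx).H`, at `d := D.gvdAt x _`,
`q̲_v̲ := D.qRootAtIdx x hx`: `D₀ := 𝒟_v̲ = CosetCat Π_{X̳̲_v̲}`; `T′ :=` GA-03's `realified d T`; `VD :=` GA-04's `catVocab d T`; **`Fr :=` THE TERM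
`temperedFrobenioid d T`** (GA-12: the [EtTh] Def. 3.6 (ii) tempered Frobenioid of the arithmetic theta tower — GENUINE constants
`(Ω^{aug U})ˣ` at every `U` through `T.proj` × GA-10's decreed theta envelope of `Π ⧸ Π_Ÿ` with the deck action of `Π`, ONE RECIPE
#342 (B)); `hF := isFrobenioid_temperedFrobenioid d T` ([FrdI] Thm. 5.2 (ii) — GA-05's hypothesis-free `isFrobenioid_realifiedOf` at the
term); `R :=` GA-16's `thetaRestBirat_of_carrierSpec (carrierSpec_temperedFrobenioid d T) hF (D.qRootAtIdx_not_isUnit x hx) l` — `Θ̲_v :=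
theta hC hF` (the Θ̈-fraction under `B(Ÿ_T) ≃* 𝒪^×(T^÷_{Ÿ_T})`), `l·ℤ := lZ hC l` with `l` the datum's prime (#341 (B); the FINITE/LABELLED
avatar, FOUNDATIONS 13 U2), the GENUINE constants `𝒪^×_{K_v̲} → 𝒪^×(T^÷_{Ÿ_v})`, `𝒞⊢_v → 𝒞_v :=` GA-13's `cdashToC hC hq` (faithful, over
`𝒟⊢_v ⊆ 𝒟_v`), and THE Θ̲-READING `𝒞^Θ_v ⊆ ℱ÷_v :=` GA-06's `cThetaToBirat hC hF hq` (#344 (B)(iii); never the constants composite).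
`ℱ÷_v := ℱ̲_v^birat`, `ℱ̲_v → ℱ÷_v := PreFrobenioid.toBirat`, `𝒪^×(T^÷_{Ÿ_v})` REAL and the `μ_{2l}` carve are then FORCED by the slot
(`BadTemperedRestBirat.toRest`).  carrier: genuine-by-[EtTh]-recipe on the T-lattice (Ÿ_T, Ÿ_T × V, X̲̲_v̲ × V) + constants everywhere;
off-lattice Φ via `rebase`/pullback; [EtTh] Def 3.3 Φ at general U and print's Ÿ̈/μ_N Kummer levels = FOUNDATIONS 13/14, not claimed
(#322 (c3′)).  GUARD (#322): at a non-theta-type `T` the carrier is print's recipe TRANSPORTED by (n_T, e(V|K_v̲)).  TYPED inhabitant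
of OUR spec — NOT print's `ℱ̲_v̲` of the actual Tate curve; COUNT-NEUTRAL; no side on [IUTchIII] Cor. 3.12; NOT an abc claim.
([IUTchI] Ex 3.2 (i) p.70) [claim: Mochizuki2012, status: disputed] -/
def badTemperedRestArith : D.BadTemperedRestBirat B x hx T :=
  haveI : Fact (D.primeAt x (D.not_mem_arc_of_mem_bad hx)).Prime := D.fact_primeAt_prime x _
  { D₀ := T.Dv
    T' := realified (D.gvdAt x _) T
    VD := catVocab (D.gvdAt x _) T
    Fr := temperedFrobenioid (D.gvdAt x _) T
    hF := isFrobenioid_temperedFrobenioid (D.gvdAt x _) T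
    R := thetaRestBirat_of_carrierSpec (carrierSpec_temperedFrobenioid (D.gvdAt x _) T)
      (isFrobenioid_temperedFrobenioid (D.gvdAt x _) T) (D.qRootAtIdx_not_isUnit x hx) l }

/-- `D₀ := 𝒟_v̲ = CosetCat Π_{X̳̲_v̲}` (the tempered Frobenioid lives over the kit's own base; #321). ([IUTchI] Ex 3.2 (i) p.70)
[claim: Mochizuki2012, status: disputed] -/
theorem badTemperedRestArith_D₀ : (D.badTemperedRestArith B x hx T).D₀ = T.Dv := rfl

/-- **`Fr :=` THE TERM `temperedFrobenioid d T`** (GA-12 F3) at `d := D.gvdAt x _`. ([IUTchI] Ex 3.2 (i) p.70) [claim: Mochizuki2012, status: disputed] -/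
theorem badTemperedRestArith_Fr :
    (D.badTemperedRestArith B x hx T).Fr =
      haveI : Fact (D.primeAt x (D.not_mem_arc_of_mem_bad hx)).Prime := D.fact_primeAt_prime x _
      temperedFrobenioid (D.gvdAt x _) T := rfl

/-- `T′ :=` GA-03's `realified d T` and `VD :=` GA-04's `catVocab d T`. ([IUTchI] Ex 3.2 (i) p.70) [claim: Mochizuki2012, status: disputed] -/
theorem badTemperedRestArith_T'_VD :
    (D.badTemperedRestArith B x hx T).T' =
        (haveI : Fact (D.primeAt x (D.not_mem_arc_of_mem_bad hx)).Prime := D.fact_primeAt_prime x _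
        realified (D.gvdAt x _) T) ∧
      (D.badTemperedRestArith B x hx T).VD =
        (haveI : Fact (D.primeAt x (D.not_mem_arc_of_mem_bad hx)).Prime := D.fact_primeAt_prime x _
        catVocab (D.gvdAt x _) T) := ⟨rfl, rfl⟩

/-- **`R :=` GA-16's assembled rest input `thetaRestBirat_of_carrierSpec hC hF hq l`** at `hC := carrierSpec_temperedFrobenioid d T`,
`hF :=` the producer's own field (`= isFrobenioid_temperedFrobenioid d T`), `hq := D.qRootAtIdx_not_isUnit x hx`, `l` the datum's prime
(`C` pinned to the producer's `Fr` so that both sides are read over the same carrier term). ([IUTchI] Ex 3.2 (ii) p.70)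
[claim: Mochizuki2012, status: disputed] -/
theorem badTemperedRestArith_R :
    (D.badTemperedRestArith B x hx T).R =
      haveI : Fact (D.primeAt x (D.not_mem_arc_of_mem_bad hx)).Prime := D.fact_primeAt_prime x _
      thetaRestBirat_of_carrierSpec (C := (D.badTemperedRestArith B x hx T).Fr) (carrierSpec_temperedFrobenioid (D.gvdAt x _) T)
        (D.badTemperedRestArith B x hx T).hF (D.qRootAtIdx_not_isUnit x hx) l := rfl

/-- **THE Θ̲-READING, read out**: `𝒞^Θ_v ⊆ ℱ÷_v` of the producer IS GA-06's `cThetaToBirat hC hF hq` («`q̲_v|_{T_A} ↦ Θ̲_v|_{T_{A^Θ}}`») —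
never the constants composite (RULINGS #344 (B)(iii); abc-iut-crit-A costume test (B)). ([IUTchI] Ex 3.2 (v) p.72) [claim: Mochizuki2012, status: disputed] -/
theorem badTemperedRestArith_CThetaToBirat :
    haveI : Fact (D.primeAt x (D.not_mem_arc_of_mem_bad hx)).Prime := D.fact_primeAt_prime x _
    letI := (D.badTemperedRestArith B x hx T).catD₀
    (D.badTemperedRestArith B x hx T).R.CThetaToBirat =
      cThetaToBirat (C := (D.badTemperedRestArith B x hx T).Fr) (carrierSpec_temperedFrobenioid (D.gvdAt x _) T)
        (D.badTemperedRestArith B x hx T).hF (D.qRootAtIdx_not_isUnit x hx) := by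
  haveI : Fact (D.primeAt x (D.not_mem_arc_of_mem_bad hx)).Prime := D.fact_primeAt_prime x _
  rw [badTemperedRestArith_R]
  exact thetaRestBirat_of_carrierSpec_CThetaToBirat _ _ _ _

/-- `Θ̲_v` of the producer IS GA-06's `theta hC hF` (the Θ̈-fraction, genuine divisor `[cusps] − [D_1]`), and its constants ARE the GENUINE
`constUnits hC hF` via `T.proj`. ([IUTchI] Ex 3.2 (ii)(v) pp.70-72) [claim: Mochizuki2012, status: disputed] -/
theorem badTemperedRestArith_theta_constUnits :
    haveI : Fact (D.primeAt x (D.not_mem_arc_of_mem_bad hx)).Prime := D.fact_primeAt_prime x _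
    letI := (D.badTemperedRestArith B x hx T).catD₀
    (D.badTemperedRestArith B x hx T).R.theta =
        theta (C := (D.badTemperedRestArith B x hx T).Fr) (carrierSpec_temperedFrobenioid (D.gvdAt x _) T)
          (D.badTemperedRestArith B x hx T).hF ∧
      (D.badTemperedRestArith B x hx T).R.constUnits =
        constUnits (C := (D.badTemperedRestArith B x hx T).Fr) (carrierSpec_temperedFrobenioid (D.gvdAt x _) T)
          (D.badTemperedRestArith B x hx T).hF := by
  haveI : Fact (D.primeAt x (D.not_mem_arc_of_mem_bad hx)).Prime := D.fact_primeAt_prime x _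
  rw [badTemperedRestArith_R]
  exact ⟨thetaRestBirat_of_carrierSpec_theta _ _ _ _, thetaRestBirat_of_carrierSpec_constUnits _ _ _ _⟩

/-- `l·ℤ` of the producer IS GA-06's `lZ hC l` at the datum's prime `l` (RULINGS #341 (B); LABELLED finite avatar, FOUNDATIONS 13 U2) and
`𝒞⊢_v → 𝒞_v` IS GA-13's `cdashToC hC hq` (sub-gap (a), non-vacuous). ([IUTchI] Ex 3.2 (ii)(iv) p.71) [claim: Mochizuki2012, status: disputed] -/
theorem badTemperedRestArith_lZ_CdashToC :
    haveI : Fact (D.primeAt x (D.not_mem_arc_of_mem_bad hx)).Prime := D.fact_primeAt_prime x _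
    letI := (D.badTemperedRestArith B x hx T).catD₀
    (D.badTemperedRestArith B x hx T).R.lZ =
        lZ (C := (D.badTemperedRestArith B x hx T).Fr) (carrierSpec_temperedFrobenioid (D.gvdAt x _) T) l ∧
      (D.badTemperedRestArith B x hx T).R.CdashToC =
        cdashToC (C := (D.badTemperedRestArith B x hx T).Fr) (carrierSpec_temperedFrobenioid (D.gvdAt x _) T)
          (D.qRootAtIdx_not_isUnit x hx) := by
  haveI : Fact (D.primeAt x (D.not_mem_arc_of_mem_bad hx)).Prime := D.fact_primeAt_prime x _
  rw [badTemperedRestArith_R]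
  exact ⟨thetaRestBirat_of_carrierSpec_lZ _ _ _ _, thetaRestBirat_of_carrierSpec_CdashToC _ _ _ _⟩

/-- **PRODUCER A of `Cruxes/ThetaPartII/GapSizingA1Sketch.lean` §1, INHABITED**: the slot `D.BadTemperedRestBirat B x hx T` is non-empty for
EVERY `(D, x ∈ V̲^bad, T)` — by THE `def`, not by a model.  COUNT-NEUTRAL (the token is the chair's). ([IUTchI] Ex 3.2 (i) p.70)
[claim: Mochizuki2012, status: disputed] -/
theorem nonempty_badTemperedRestBirat : Nonempty (D.BadTemperedRestBirat.{0} B x hx T) := ⟨D.badTemperedRestArith B x hx T⟩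

/-- The weaker rest form of the slot is inhabited too (`BadTemperedRestBirat.toRest`). ([IUTchI] Ex 3.2 (i) p.70) [claim: Mochizuki2012, status: disputed] -/
theorem nonempty_badTemperedRest : Nonempty (D.BadTemperedRest.{0} B x hx T) := ⟨(D.badTemperedRestArith B x hx T).toRest⟩

end Producer

/-! ### §2 The merge record AT THE GENUINE (m1): `MergeInputs.ofArith` -/

section Merge

variable (m2 : ∀ x (hx : x ∈ D.indexCopyBad), BadLocalGroupDatum (D.GalAt x (D.not_mem_arc_of_mem_bad hx)) ↥(B x hx).H)
  (m4 : RealifiedGlobalSide) (geomTFG : D.geom.extF.GeomTFG)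

/-- **The merge record whose (m1) IS the GENUINE producer at every bad index** — `MergeInputs.ofRestBirat` at
`fun x hx => D.badTemperedRestArith B x hx (m2 x hx)`; binders (m2) the Ex. 3.2 group data, (m4) the Ex. 3.5 realified global side,
FACT F-0240 — (m1) is PRODUCED, not posited. ([IUTchI] Def 5.2 (i) p.134) [claim: Mochizuki2012, status: disputed] -/
def MergeInputs.ofArith : D.MergeInputs B :=
  MergeInputs.ofRestBirat D B m2 (fun x hx => D.badTemperedRestArith B x hx (m2 x hx)) m4 geomTFG

/-- It IS `ofRestBirat` at the genuine (m1). ([IUTchI] Def 5.2 (i) p.134) [claim: Mochizuki2012, status: disputed] -/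
theorem MergeInputs.ofArith_eq : MergeInputs.ofArith D B m2 m4 geomTFG =
    MergeInputs.ofRestBirat D B m2 (fun x hx => D.badTemperedRestArith B x hx (m2 x hx)) m4 geomTFG := rfl

/-- Its (m1) slot at `x` is the `TemperedThetaInput`-shaped side of the producer, and its (m2)/(m4) slots are the given ones.
([IUTchI] Def 5.2 (i) p.134) [claim: Mochizuki2012, status: disputed] -/
theorem MergeInputs.ofArith_m1 (x : D.IndexCopy) (hx : x ∈ D.indexCopyBad) :
    (MergeInputs.ofArith D B m2 m4 geomTFG).m1 x hx = (D.badTemperedRestArith B x hx (m2 x hx)).toRest.toSide ∧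
      (MergeInputs.ofArith D B m2 m4 geomTFG).m2 = m2 ∧ (MergeInputs.ofArith D B m2 m4 geomTFG).m4 = m4 := ⟨rfl, rfl, rfl⟩

/-- **`MergeInputs` at `𝒞⊩_mod` with GENUINE (m1)**: (m4) := abc-iut-L5-t2's `realifiedGlobalSideOfModuli` (★ p497530) — binders (m2) and
FACT F-0240 ONLY. ([IUTchI] Def 5.2 (iv) p.134) [claim: Mochizuki2012, status: disputed] -/
def MergeInputs.ofArithModuli (hTFG : D.geom.extF.GeomTFG) : D.MergeInputs B :=
  MergeInputs.ofArith D B m2 D.realifiedGlobalSideOfModuli hTFG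

/-! ### §3 THE NV ONE-CALLS at a genuine bad index (RULINGS #319 (c1): no law vacuous) -/

variable (x : D.IndexCopy) (hx : x ∈ D.indexCopyBad)

/-- **[IUTchI] Ex. 3.2 (ii) AT THE GENUINE (m1) — residual binders NONE**: «`ℱ÷_v := ℱ̲_v^birat` may be reconstructed category-theoretically
from `ℱ̲_v`» (`BiratFromF`) HOLDS at `frobeniusBadAt B (MergeInputs.ofArith …) x hx` for EVERY bad index — `…TemperedBiratReal` §4's
`biratFromF_frobeniusBadAt_ofRestBirat` at the producer ([FrdI] Cor. 4.10 with Thm. 3.4 (ii) a theorem; `hF` the datum's own, `hb` by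
construction). ([IUTchI] Ex 3.2 (ii) p.70) [claim: Mochizuki2012, status: disputed] -/
theorem biratFromF_frobeniusBadAt_ofArith [Fact (D.primeAt x (D.not_mem_arc_of_mem_bad hx)).Prime] :
    (D.frobeniusBadAt B (MergeInputs.ofArith D B m2 m4 geomTFG) x hx).BiratFromF :=
  D.biratFromF_frobeniusBadAt_ofRestBirat B m2 (fun x hx => D.badTemperedRestArith B x hx (m2 x hx)) m4 geomTFG x hx

/-- **[IUTchI] Ex. 3.2 (iii) AT THE GENUINE (m1), the [EtTh] Cor. 3.8 (ii) bundle DISCHARGED under H+**: «`𝒞_v ⊆ ℱ̲_v` may be reconstructed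
category-theoretically from `ℱ̲_v`» (`CFromF`) at `frobeniusBadAt B (MergeInputs.ofArith …) x hx` — ★ p498213 `cFromF_frobeniusBadAt_ofRest` with
`hnd := isNonDilating_temperedFrobenioid d T` (GA-08 ★ p677621 = `isNonDilating_of_carrierSpec hC hD`, `hD := pullDichotomy_temperedFrobenioid d T`, H+ at
EVERY object, binder-free), `hF := isFrobenioid_temperedFrobenioid d T`, `h5 := cor38ii_h5_of_carrierSpec hC hF hP34Λ hZQ`, `hR := cor38ii_hR C hP34Λ hFinv`
(GA-14 ★ p670391, #342 (D)) with r1 `hP34Λ := realified_mem_FΛ_of_divΛ_eq_of d T`, r2 `hFinv := realified_exists_inv_FΛ d T`, r3 `hZQ :=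
realified_isZQMonoprime d T` (GA-02 ★ p676754, BY NAME) — modulo the Div-slimness clause `hds` of `𝒟_v̲` ONLY (discharged below from the pair
closed + slim). ([IUTchI] Ex 3.2 (iii) p.71)
[claim: Mochizuki2012, status: disputed] -/
theorem cFromF_frobeniusBadAt_ofArith [Fact (D.primeAt x (D.not_mem_arc_of_mem_bad hx)).Prime]
    (hds : ∀ (A : (m2 x hx).Dv) (α : Aut (Over.forget A)),
      (∀ (B' : Over A) (y : (temperedFrobenioid (D.gvdAt x (D.not_mem_arc_of_mem_bad hx)) (m2 x hx)).divisorMonoid.obj (op B'.left)),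
        Literature.AlgebraicGeometry.Frobenioids.pull
          (temperedFrobenioid (D.gvdAt x (D.not_mem_arc_of_mem_bad hx)) (m2 x hx)).divisorMonoid (α.hom.app B') y = y) → α = 1) :
    (D.frobeniusBadAt B (MergeInputs.ofArith D B m2 m4 geomTFG) x hx).CFromF :=
  D.cFromF_frobeniusBadAt_ofRest B m2 (fun x hx => (D.badTemperedRestArith B x hx (m2 x hx)).toRest) m4 geomTFG x hx
    (isNonDilating_temperedFrobenioid (D.gvdAt x _) (m2 x hx)) hds (isFrobenioid_temperedFrobenioid (D.gvdAt x _) (m2 x hx))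
    (cor38ii_h5_of_carrierSpec (carrierSpec_temperedFrobenioid (D.gvdAt x _) (m2 x hx))
      (isFrobenioid_temperedFrobenioid (D.gvdAt x _) (m2 x hx)) (realified_mem_FΛ_of_divΛ_eq_of (D.gvdAt x _) (m2 x hx))
      (realified_isZQMonoprime (D.gvdAt x _) (m2 x hx)))
    (cor38ii_hR (temperedFrobenioid (D.gvdAt x _) (m2 x hx)) (realified_mem_FΛ_of_divΛ_eq_of (D.gvdAt x _) (m2 x hx))
      (realified_exists_inv_FΛ (D.gvdAt x _) (m2 x hx)))

/-- **(iii) AT THE GENUINE (m1) for every CLOSED bad pair whose `Π_v̲ = ↥(B x hx).H` is slim — NO L2-input binder, NO Cor. 3.8 (ii) binder**: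
`hds` := ★ p511706 `divSlim_cosetCat_of_isSlimGroup` (`Π_v̲` tempered by ★ p497246 `isTempered_badPair_of_isClosed`), the rest as in
`cFromF_frobeniusBadAt_ofArith`; group side {`hH`, `hZ`} only. ([IUTchI] Ex 3.2 (iii) p.71) [claim: Mochizuki2012, status: disputed] -/
theorem cFromF_frobeniusBadAt_ofArith_of_isSlimGroup [Fact (D.primeAt x (D.not_mem_arc_of_mem_bad hx)).Prime]
    (hH : IsClosed ((B x hx).H : Set D.PiC)) (hZ : IsSlimGroup ↥(B x hx).H) :
    (D.frobeniusBadAt B (MergeInputs.ofArith D B m2 m4 geomTFG) x hx).CFromF :=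
  D.cFromF_frobeniusBadAt_ofRest_of_isSlimGroup B m2 (fun x hx => (D.badTemperedRestArith B x hx (m2 x hx)).toRest) m4 geomTFG
    x hx hH hZ (isNonDilating_temperedFrobenioid (D.gvdAt x _) (m2 x hx)) (isFrobenioid_temperedFrobenioid (D.gvdAt x _) (m2 x hx))
    (cor38ii_h5_of_carrierSpec (carrierSpec_temperedFrobenioid (D.gvdAt x _) (m2 x hx))
      (isFrobenioid_temperedFrobenioid (D.gvdAt x _) (m2 x hx)) (realified_mem_FΛ_of_divΛ_eq_of (D.gvdAt x _) (m2 x hx))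
      (realified_isZQMonoprime (D.gvdAt x _) (m2 x hx)))
    (cor38ii_hR (temperedFrobenioid (D.gvdAt x _) (m2 x hx)) (realified_mem_FΛ_of_divΛ_eq_of (D.gvdAt x _) (m2 x hx))
      (realified_exists_inv_FΛ (D.gvdAt x _) (m2 x hx)))

/-- **(iii) AT THE GENUINE (m1) for every CLOSED bad pair with slim `Δ_H`** (`hZ` ⟸ ★ p507547 `isSlimGroup_of_isClosed_badPair`); group side
{`hH`, `hK`} only. ([IUTchI] Ex 3.2 (iii) p.71) [claim: Mochizuki2012, status: disputed] -/
theorem cFromF_frobeniusBadAt_ofArith_of_isClosed_of_ker_slim [Fact (D.primeAt x (D.not_mem_arc_of_mem_bad hx)).Prime]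
    (hH : IsClosed ((B x hx).H : Set D.PiC)) (hK : IsSlimGroup (D.m2OfClosed B x hx hH).aug.ker) :
    (D.frobeniusBadAt B (MergeInputs.ofArith D B m2 m4 geomTFG) x hx).CFromF :=
  D.cFromF_frobeniusBadAt_ofArith_of_isSlimGroup B m2 m4 geomTFG x hx hH (D.isSlimGroup_of_isClosed_badPair B x hx hH hK)

/-- **[IUTchI] Ex. 3.2 (ii) ∧ (iii) JOINTLY AT THE GENUINE (m1)**: (ii) UNCONDITIONAL, (iii) modulo the Div-slimness clause `hds` of `𝒟_v̲`
only (`…TemperedBiratReal` §4's `ex32_ii_iii_frobeniusBadAt_ofRestBirat` with {`hnd`, `h5`, `hR`} discharged at the term). ([IUTchI] Ex 3.2 (ii)(iii) pp.70-71)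
[claim: Mochizuki2012, status: disputed] -/
theorem ex32_ii_iii_frobeniusBadAt_ofArith [Fact (D.primeAt x (D.not_mem_arc_of_mem_bad hx)).Prime]
    (hds : ∀ (A : (m2 x hx).Dv) (α : Aut (Over.forget A)),
      (∀ (B' : Over A) (y : (temperedFrobenioid (D.gvdAt x (D.not_mem_arc_of_mem_bad hx)) (m2 x hx)).divisorMonoid.obj (op B'.left)),
        Literature.AlgebraicGeometry.Frobenioids.pull
          (temperedFrobenioid (D.gvdAt x (D.not_mem_arc_of_mem_bad hx)) (m2 x hx)).divisorMonoid (α.hom.app B') y = y) → α = 1) :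
    (D.frobeniusBadAt B (MergeInputs.ofArith D B m2 m4 geomTFG) x hx).BiratFromF ∧
      (D.frobeniusBadAt B (MergeInputs.ofArith D B m2 m4 geomTFG) x hx).CFromF :=
  ⟨D.biratFromF_frobeniusBadAt_ofArith B m2 m4 geomTFG x hx, D.cFromF_frobeniusBadAt_ofArith B m2 m4 geomTFG x hx hds⟩

/-- **(ii) ∧ (iii) AT THE GENUINE (m1) for every CLOSED bad pair with slim `Π_v̲`** — group side {`hH`, `hZ`} only, NO L2-input binder.
([IUTchI] Ex 3.2 (ii)(iii) pp.70-71) [claim: Mochizuki2012, status: disputed] -/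
theorem ex32_ii_iii_frobeniusBadAt_ofArith_of_isSlimGroup [Fact (D.primeAt x (D.not_mem_arc_of_mem_bad hx)).Prime]
    (hH : IsClosed ((B x hx).H : Set D.PiC)) (hZ : IsSlimGroup ↥(B x hx).H) :
    (D.frobeniusBadAt B (MergeInputs.ofArith D B m2 m4 geomTFG) x hx).BiratFromF ∧
      (D.frobeniusBadAt B (MergeInputs.ofArith D B m2 m4 geomTFG) x hx).CFromF :=
  ⟨D.biratFromF_frobeniusBadAt_ofArith B m2 m4 geomTFG x hx,
    D.cFromF_frobeniusBadAt_ofArith_of_isSlimGroup B m2 m4 geomTFG x hx hH hZ⟩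

/-- **[IUTchI] Ex. 3.2 (iii) ∧ (vi)(c) ∧ (vi)(d) JOINTLY AT THE GENUINE (m1), for every CLOSED bad pair with slim `Δ_H`**: (vi)(c) UNCONDITIONAL
(★ p497246), (iii) with the Cor. 3.8 (ii) bundle DISCHARGED at the term and `hds` from the slim pair, (vi)(d) modulo the [FrdI] Thm. 3.4 (v)
bundles {`hF′`, `hC`} (★ p507547); group side {`hH`, `hK`} — and NOTHING on the L2 input (★ p511706
`ex32_iii_vi_cd_frobeniusBadAt_ofRest_of_isClosed_of_ker_slim` at the producer). ([IUTchI] Ex 3.2 (vi) p.73) [claim: Mochizuki2012, status: disputed] -/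
theorem ex32_iii_vi_cd_frobeniusBadAt_ofArith_of_isClosed_of_ker_slim [Fact (D.primeAt x (D.not_mem_arc_of_mem_bad hx)).Prime]
    (hH : IsClosed ((B x hx).H : Set D.PiC)) (hK : IsSlimGroup (D.m2OfClosed B x hx hH).aug.ker)
    (hF' : ∀ e : (temperedFrobenioid (D.gvdAt x (D.not_mem_arc_of_mem_bad hx)) (m2 x hx)).category ≌
        (temperedFrobenioid (D.gvdAt x (D.not_mem_arc_of_mem_bad hx)) (m2 x hx)).category,
      FrdI.Thm34Sub.StdHyp (temperedFrobenioid (D.gvdAt x (D.not_mem_arc_of_mem_bad hx)) (m2 x hx)).toElem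
        (temperedFrobenioid (D.gvdAt x (D.not_mem_arc_of_mem_bad hx)) (m2 x hx)).toElem e)
    (hC : ∀ e : (temperedFrobenioid (D.gvdAt x (D.not_mem_arc_of_mem_bad hx)) (m2 x hx)).hullCategory ≌
        (temperedFrobenioid (D.gvdAt x (D.not_mem_arc_of_mem_bad hx)) (m2 x hx)).hullCategory,
      FrdI.Thm34Sub.StdHyp
        (ModelFrobenioid.toElem (temperedFrobenioid (D.gvdAt x (D.not_mem_arc_of_mem_bad hx)) (m2 x hx)).bsFldMonoid
          (temperedFrobenioid (D.gvdAt x (D.not_mem_arc_of_mem_bad hx)) (m2 x hx)).cnstFnBsFunctor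
          (temperedFrobenioid (D.gvdAt x (D.not_mem_arc_of_mem_bad hx)) (m2 x hx)).divFNatTrans)
        (ModelFrobenioid.toElem (temperedFrobenioid (D.gvdAt x (D.not_mem_arc_of_mem_bad hx)) (m2 x hx)).bsFldMonoid
          (temperedFrobenioid (D.gvdAt x (D.not_mem_arc_of_mem_bad hx)) (m2 x hx)).cnstFnBsFunctor
          (temperedFrobenioid (D.gvdAt x (D.not_mem_arc_of_mem_bad hx)) (m2 x hx)).divFNatTrans) e) :
    (D.frobeniusBadAt B (MergeInputs.ofArith D B m2 m4 geomTFG) x hx).CFromF ∧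
      (D.frobeniusBadAt B (MergeInputs.ofArith D B m2 m4 geomTFG) x hx).BasesFromC ∧
      (D.frobeniusBadAt B (MergeInputs.ofArith D B m2 m4 geomTFG) x hx).DFromF :=
  D.ex32_iii_vi_cd_frobeniusBadAt_ofRest_of_isClosed_of_ker_slim B m2
    (fun x hx => (D.badTemperedRestArith B x hx (m2 x hx)).toRest) m4 geomTFG x hx hH hK
    (isNonDilating_temperedFrobenioid (D.gvdAt x _) (m2 x hx)) (isFrobenioid_temperedFrobenioid (D.gvdAt x _) (m2 x hx))
    (cor38ii_h5_of_carrierSpec (carrierSpec_temperedFrobenioid (D.gvdAt x _) (m2 x hx))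
      (isFrobenioid_temperedFrobenioid (D.gvdAt x _) (m2 x hx)) (realified_mem_FΛ_of_divΛ_eq_of (D.gvdAt x _) (m2 x hx))
      (realified_isZQMonoprime (D.gvdAt x _) (m2 x hx)))
    (cor38ii_hR (temperedFrobenioid (D.gvdAt x _) (m2 x hx)) (realified_mem_FΛ_of_divΛ_eq_of (D.gvdAt x _) (m2 x hx))
      (realified_exists_inv_FΛ (D.gvdAt x _) (m2 x hx))) hF' hC

end Merge

/-! ### §4 (iii) AT THE STAND-IN FAMILY with GENUINE (m1): modulo F-0004₁ only (chair's optional rider, RULINGS #362) -/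

section StandIn

variable (hA : D.geom.pe.ArrowCoveringClaims) (CG : D.geom.pe.CuspGalois) (x : D.IndexCopy) (hx : x ∈ D.indexCopyBad)

/-- **[IUTchI] Ex. 3.2 (iii) AT THE STAND-IN FAMILY (`B := badPairAtArrow hA`, (m2) := `m2StandIn`) WITH THE GENUINE (m1)** — every [EtTh]
Cor. 3.8 (ii) instance hypothesis fed BY NAME at the term as in `cFromF_frobeniusBadAt_ofArith`, `hH`/`hZ` DISCHARGED at the stand-in
(★ p501395 `isClosed_badPairAtArrow_H`, ★ p507547 `isSlimGroup_badPairAtArrow_H_of_geom_slim`): `CFromF` at `frobeniusBadAt (badPairAtArrow hA)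
(MergeInputs.ofArith … (m2StandIn …) m4 hTFG) x hx` modulo the merge's own origin inputs (`hA`, `CG`, F-0240 `hTFG`) and F-0004₁ `hΔC : IsSlimGroup
D.DeltaC` ONLY (★ p511706 `cFromF_frobeniusBadAt_ofRest_standIn_of_geom_slim` at the producer).  The stand-in datum has `Π_Ÿ = ⊤` (GUARD #322:
the carrier there is print's recipe TRANSPORTED; a non-vacuity reading of the (iii) law, not a theta-type level). ([IUTchI] Ex 3.2 (iii) p.71)
[claim: Mochizuki2012, status: disputed] -/
theorem cFromF_frobeniusBadAt_ofArith_standIn_of_geom_slim (hTFG : D.geom.extF.GeomTFG) (m4 : RealifiedGlobalSide)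
    [Fact (D.primeAt x (D.not_mem_arc_of_mem_bad hx)).Prime] (hΔC : IsSlimGroup D.DeltaC) :
    (D.frobeniusBadAt _ (MergeInputs.ofArith D (fun u _ => D.badPairAtArrow hA u)
      (fun v hv => haveI : Fact (D.primeAt v (D.not_mem_arc_of_mem_bad hv)).Prime := D.fact_primeAt_prime v _
        D.m2StandIn hA CG hTFG v (D.not_mem_arc_of_mem_bad hv)) m4 hTFG) x hx).CFromF :=
  D.cFromF_frobeniusBadAt_ofRest_standIn_of_geom_slim hA CG x hx hTFG
    (fun v hv => haveI : Fact (D.primeAt v (D.not_mem_arc_of_mem_bad hv)).Prime := D.fact_primeAt_prime v _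
      (D.badTemperedRestArith (fun u _ => D.badPairAtArrow hA u) v hv (D.m2StandIn hA CG hTFG v (D.not_mem_arc_of_mem_bad hv))).toRest)
    m4 (isNonDilating_temperedFrobenioid (D.gvdAt x _) (D.m2StandIn hA CG hTFG x (D.not_mem_arc_of_mem_bad hx)))
    (isFrobenioid_temperedFrobenioid (D.gvdAt x _) (D.m2StandIn hA CG hTFG x (D.not_mem_arc_of_mem_bad hx)))
    (cor38ii_h5_of_carrierSpec (carrierSpec_temperedFrobenioid (D.gvdAt x _) (D.m2StandIn hA CG hTFG x (D.not_mem_arc_of_mem_bad hx)))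
      (isFrobenioid_temperedFrobenioid (D.gvdAt x _) _) (realified_mem_FΛ_of_divΛ_eq_of (D.gvdAt x _) _)
      (realified_isZQMonoprime (D.gvdAt x _) _))
    (cor38ii_hR (temperedFrobenioid (D.gvdAt x _) (D.m2StandIn hA CG hTFG x (D.not_mem_arc_of_mem_bad hx)))
      (realified_mem_FΛ_of_divΛ_eq_of (D.gvdAt x _) _) (realified_exists_inv_FΛ (D.gvdAt x _) _)) hΔC

end StandIn

end InitialThetaData

end Literature.IUT.HodgeTheaters

end
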